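import Mathlib
import Literature.AlgebraicGeometry.Resolution.BlowupStrictTransform
import HarnessLib

/-!
# Programme V3U: a principal chart of a blow-up with an INVARIANT chart generator is stable under the lifted action

(crux stmt-ResolutionOfSingularities-15640 `WildQuotients.WildQuotientResolution`, line `Sketch`,
sector `|G| = p`; programme V3U of `L/w45c/CHAIN.md` v5 §4 row stub-2 «cover» —
`D₊(x_a t)` is `σ`-stable because `x_a` is invariant; [OURS · L1 W4.5c] — NOT a statement of any
manuscript.)

Let `π : X' → X` be a blow-up along `I` (`IsBlowup`), `α : X' ≅ X'` over `β : X ≅ X`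
(`α ≫ π = π ≫ β`) with `β⁻¹ I = I`, and `b ∈ I(X)` (`X` affine) a generator FIXED by `β`
(`β^* b = b`). Then the principal chart `X'[X, b] = D₊(b t)` — the locus where `π^* b` is a
non-zero-divisor generating `I·𝒪_{X'}` (`blowupChart`, Literature `BlowupPrincipalCharts`) — is
`α`-stable: `α⁻¹ X'[X, b] = X'[X, b]` (`preimage_blowupChart_eq_self`, from the tree's
`preimage_blowupChart_eq` for the square `(α, β)`). Group form `preimage_blowupChart_eq_self_of_action`
and the affine-quotient-law instance `specAction_appTop_ΓSpecIso_inv` (`ρ g = Spec (g⁻¹)`, `g • x = x`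
⇒ `(ρ g)^* x = x`): for `V = Bl_{(x_a,x_b²)} 𝔸ⁿ` and the lifted `⟨σ⟩`-action, `D₊(x_a t)` is stable
(any lift `ρV` with `ρV g ≫ π = π ≫ ρ g`, in particular `IsBlowup.liftAction`), so that with
`ToricExit.exists_stable_affine_cover_pair` the glued quotient `V/σ` is the union of the cone piece
`D₊(x_a t)/σ` and a regular piece `W_b/σ`, `W_b ⊆ D₊(x_b² t)`.
-/

-- single-problem summit: the doubled namespace component `ResolutionOfSingularities` is forced
set_option linter.dupNamespace false

noncomputable section

open CategoryTheory AlgebraicGeometry TopologicalSpace Literature.AlgebraicGeometry.Resolution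

namespace Summit.ResolutionOfSingularities.ResolutionOfSingularities.Theorems.WildQuotientResolution.ToricExit

universe u

/-- **A principal chart with invariant generator is stable**: for a blow-up `π : X' → X` along `I`
(`X` affine), an automorphism `α` of `X'` over an automorphism `β` of `X` with `β⁻¹ I = I`, and
`b ∈ I(X)` with `β^* b = b`, one has `α⁻¹ X'[X, b] = X'[X, b]`. [folklore] -/
theorem preimage_blowupChart_eq_self {X X' : Scheme.{u}} [IsAffine X] {I : X.IdealSheafData}
    {π : X' ⟶ X} (hπ : IsBlowup π I) (α : X' ≅ X') (β : X ≅ X)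
    (hequiv : α.hom ≫ π = π ≫ β.hom) (hI : I.comap β.hom = I)
    {b : Γ(X, ⊤)} (hb : b ∈ I.ideal ⟨⊤, isAffineOpen_top X⟩) (hg : β.hom.appTop b = b) :
    α.hom ⁻¹ᵁ blowupChart π I ⟨⊤, isAffineOpen_top X⟩ b =
      blowupChart π I ⟨⊤, isAffineOpen_top X⟩ b := by
  have hρ : IsBlowup π (I.comap β.hom) := by rw [hI]; exact hπ
  rw [preimage_blowupChart_eq hπ hρ hequiv ⟨⊤, isAffineOpen_top X⟩ hb]
  have hg' : β.hom.appLE ⊤ (β.hom ⁻¹ᵁ ⊤) le_rfl b = b := by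
    rw [Scheme.Hom.appLE_eq_app]; exact hg
  have key : ∀ (J : X.IdealSheafData) (_ : J = I) (b' : Γ(X, ⊤)) (_ : b' = b),
      blowupChart π J (preimageAffineOpens β.hom ⟨⊤, isAffineOpen_top X⟩) b' =
        blowupChart π I ⟨⊤, isAffineOpen_top X⟩ b := by
    rintro J rfl b' rfl
    rfl
  exact key _ hI _ hg'

/-- **Group form**: if `G` acts on `X' → X` equivariantly (`ρ' g ≫ π = π ≫ ρ g`), every `ρ g`
preserves `I` and fixes `b ∈ I(X)`, then the principal chart `X'[X, b]` is `G`-stable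
(in particular for `ρ' = IsBlowup.liftAction ρ _`). [folklore] -/
theorem preimage_blowupChart_eq_self_of_action {X X' : Scheme.{u}} [IsAffine X]
    {I : X.IdealSheafData} {π : X' ⟶ X} (hπ : IsBlowup π I) {G : Type*} [Group G]
    (ρ : G →* Aut X) (ρ' : G →* Aut X') (hequiv : ∀ g : G, (ρ' g).hom ≫ π = π ≫ (ρ g).hom)
    (hI : ∀ g : G, I.comap (ρ g).hom = I) {b : Γ(X, ⊤)}
    (hb : b ∈ I.ideal ⟨⊤, isAffineOpen_top X⟩) (hg : ∀ g : G, (ρ g).hom.appTop b = b) (g : G) :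
    (ρ' g).hom ⁻¹ᵁ blowupChart π I ⟨⊤, isAffineOpen_top X⟩ b =
      blowupChart π I ⟨⊤, isAffineOpen_top X⟩ b :=
  preimage_blowupChart_eq_self hπ (ρ' g) (ρ g) (hequiv g) (hI g) hb (hg g)

/-- **The affine-quotient law fixes the sections of invariants**: for `ρ g = Spec (g⁻¹)` on
`Spec B` and `x ∈ B` with `g • x = x` for all `g`, `(ρ g)^* x = x` in `Γ(Spec B, ⊤)` (through
`ΓSpecIso`). This is the hypothesis `hg` of `preimage_blowupChart_eq_self_of_action` for the V3U
chart `D₊(x_a t)` (`σ x_a = x_a`). [folklore] -/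
theorem specAction_appTop_ΓSpecIso_inv {B : Type u} [CommRing B] {G : Type*} [Group G]
    [MulSemiringAction G B] (ρ : G →* Aut (Spec (CommRingCat.of B)))
    (hρ : ∀ g : G, (ρ g).hom = Spec.map (CommRingCat.ofHom
      ((MulSemiringAction.toRingEquiv G B g⁻¹ : B ≃+* B) : B →+* B)))
    (x : B) (hx : ∀ g : G, g • x = x) (g : G) :
    (ρ g).hom.appTop ((Scheme.ΓSpecIso (CommRingCat.of B)).inv x) =
      (Scheme.ΓSpecIso (CommRingCat.of B)).inv x := by
  rw [hρ g]
  have h := Scheme.ΓSpecIso_inv_naturality (CommRingCat.ofHom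
    ((MulSemiringAction.toRingEquiv G B g⁻¹ : B ≃+* B) : B →+* B))
  have hx' : ((MulSemiringAction.toRingEquiv G B g⁻¹ : B ≃+* B) : B →+* B) x = x := by
    change (MulSemiringAction.toRingEquiv G B g⁻¹) x = x
    rw [MulSemiringAction.toRingEquiv_apply_apply, hx]
  have h' := congrArg (fun φ => φ x) (congrArg (fun φ : CommRingCat.of B ⟶ _ => ⇑φ.hom) h)
  simp only [CommRingCat.hom_comp, RingHom.coe_comp, Function.comp_apply,
    CommRingCat.hom_ofHom, hx'] at h'
  exact h'.symm

end Summit.ResolutionOfSingularities.ResolutionOfSingularities.Theorems.WildQuotientResolution.ToricExit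

end
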